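import Summits.QuantumFields.YangMills.Theorems.BalabanUVNodesN07AxialTowerRepresentative
import Summits.QuantumFields.YangMills.Theorems.BalabanUVNodesN07Lemma1CrossingBondsAtRecord
import Summits.QuantumFields.Balaban3D.Carriers.RadialContour
import HarnessLib

/-!
# DAG node N07 [B11] — Sect. F's AXIAL TOWER AT THE RECORD ON [B5] (1.7)'s SINGLE CONTOURS `Γ_{y,x}` (road (S) of this base's LOCATED-TOWER-CONTOUR): the tower of [6] (1.15)
# keyed on pub-balaban3d's `radialContourData` — every residual orbit carries it, W.L.O.G. the minimiser of record does, block-constant lifts keep it, the sheared average (88)∕(154)₁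
# reads on it with the empty-contour clause DISCHARGED, and n07-w5's Lemma 1 ([6] (1.25)) runs ONE STEP of (155) down it with the within-block letter displayed

Cell `pub-ymgap` (HUMAN RULINGS D-0062 ∕ D-0088 ∕ D-0149), width seat `pub-ymgap-dag-n07-w6` (second wave), harness re-seat g0″, 2026-08-28; CLAIM-4 (own lineage p610328 `…N07AxialTowerRepresentative`,
which is GENERIC in the contour system; LOCATED-TOWER-CONTOUR + ADDENDUM on the cell bus; ROAD WORD (S) «Sect. F's tower keyed on `radialContourData` = [6] (1.15) ∕ [B5] (1.7) = [B11]
p. 300; (F) declined, (T) superseded» by the lane owner dag-n07-e g21, cell bus 2026-08-28 11:21Z).  `--kind proof --supports stmt-QuantumFields-27364 --as helper` (K1⁹ per dag-lead KEY MAP v2;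
count-neutral).  THEOREMS ONLY.

WHY.  The (r4)∕(r2) record rows take per level `j ≤ k` the data letter `v_j = dist1 (M^j(U′)(c))` of the ONE representative `U′`; for `j < k` this is [B11] (155), which print derives from (7) and the
axial gauge conditions of the tower — [6] (1.15) with the SINGLE contours `Γ_{y,x}` ([B5] (1.7) ∕ [3] (0.3)).  The record's `Node00.contourOfRecord` is [I] (0.11)'s Federbush-AVERAGED contour
variables (the device of the gauge fixing `𝐆`), for which «averaged contour `= 1`» does not by itself bound single bonds.  The axial tower of Sect. F is a device INSIDE the variational analysis,
independent of `𝐆`; keyed on `radialContourData` it is print's own, and the within-block half of (155) becomes a tree-gauge count (n07-w5's lane), the crossing-bond half n07-w5's landed Lemma 1.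

THE PRINT.  [B11] = [Balaban1985Variational] p. 300 (Sect. F, first step) «Applying a gauge transformation to U_k we get a configuration U′_k such, that U′_k ∈ Ax_k(□̃(k), 1)», p. 302 (155);
[6] = [Balaban1985RegularSpaces] (1.14)–(1.15) p. 78 («U(Γ_{x₁,x}) = 1 for x ∈ B(x₁)»), Lemma 1 (1.25) p. 79; [B5] = [Balaban1984PropagatorsI] (1.7) p. 18 (the contour `Γ_{y,x}`: last coordinate
first); [3] = [Balaban1985Averaging] (85)–(88) p. 31; [I] = [Balaban1987RG1] (0.11) p. 253, (0.21) p. 256.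

WHAT THIS FILE DOES (kernel gauge algebra + by-name composition; NOTHING of [B11]∕[6]∕[B5]∕[3] analysis asserted).
* §1 (generic `P`, `G`): `moveHol_self` ∕ `pathHol_self` ∕ ★ `radialHol_emb_self` — the contour from the centre to the centre is empty: `U(Γ_{y,y}) = 1` for EVERY `U` (induction on the coordinate list;
  pub-balaban3d's `radialHol_one` is the `U = 1` case); `radial_hctr` — the `hctr` clause of p608036 ∕ p610328 for `radialContourData`, DISCHARGED.
* §2 AT THE RECORD: ★★ `exists_residual_radialTower_record` (every residual orbit of level `j ≤ m + K` carries the RADIAL tower, p610328 `exists_residual_axialTower` at `cd := radialContourData`);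
  ★★ `exists_radialTower_isBackground` (W.L.O.G. the minimiser of record over `V` in `bgReg` carries the radial tower — residual copy, same data; p610328 §3's proof at the radial datum);
  ★ `existsUnique_radialTower_in_orbit` ((1.15)'s «determine uniquely an element in each orbit», p610328 `existsUnique_axialTower_in_orbit`); `radialTower_gaugeAct_blockLift` (block-constant lifts
  from level `j` keep the radial tower — the representative `U′^{h̄}` of this base's `…TowerGauge` `_of_rep` forms keeps it).
* §3 THE SHEAR LETTERS ON THE RADIAL TOWER: ★ `shearRIter_radial_eq_one_of_axialTower` (`S_j(U′) = 1`, p610328 §2 with `radial_hctr`); ★★ `shearedAvgIter_radial_eq_iter_gauge` — (88)∕(154)₁ AT THE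
  RECORD for the radial shear letters: p608036 `shearedAvgIter_avOfRecord_eq_iter_gauge_cd` with its displayed `hctr` DISCHARGED (only the radial axial gauges below `j` and the (81)∕(1.29) normalisation
  of `u` at the bond's ends remain); ★★ `shearedAvgIter_radial_eq_dataAxial_of_rep` — the same in the knit's shape (`U₁^{u} = U′^{h̄}`, `h := axialGauge (M^j U′) lo hi`): `𝒜_j(U₁)(c) = (V^h)(c)`.
* §4 ONE STEP OF (155) DOWN THE TOWER (n07-w5's Lemma 1 at the representative's own averages): ★★ `dist1_crossingBond_iter_le_of_succ` — for ANY `U′`, level `j + 1 ≤ m + K`, a `(j+1)`-bond `c`: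
  if the level-`j` plaquettes of `M^j U′` based in `B(c₋ − e_μ) ∪ B(c₋) ∪ B(c₊)` are `< a` ((7) at level `j`), `t := ((d+2)L)²∕4·a < δ_N`, the NEXT level's bond letter `dist1 (M^{j+1}U′(c)) ≤ α`
  and the within-block letter `dist1 (M^j U′ b) ≤ τ` on `B(c₋)`, `B(c₊)` (`hint` — DISPLAYED; on the radial tower it is the tree-gauge count from `AxialGauge (radialContourData …) (M^j U′)`,
  n07-w5 g2's offered supplier), then every far-face crossing bond has `dist1 (M^j U′ ⟨blockSite c₋ r, μ⟩) ≤ α + 7t + (d+1)(L−1)τ` — n07-w5 p612161-lineage `dist1_crossingBond_le_at_record` at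
  `W := M^j U′` (`M^{j+1} = (avOfRecord j).avg ∘ M^j` by `rfl`).
* §5 (A6) NON-VACUITY: `radialTower_one` — the unit configuration carries the radial tower at every depth (`iter_avOfRecord_one`, `radialHol_one`); with p610328's `hax_inhabited_of_orbit` pattern
  every binder block above is inhabited.

HONEST FRAMING (binding).  Count-neutral helper; by-name composition of LANDED theorems (this base p610328 ∕ p608036, pub-balaban3d `Carriers.RadialContour` (a `Summits → Summits` import the gate
accepts, dry-run probe 2026-08-28 11:07Z), dag-n07-w5 `…Lemma1CrossingBondsAtRecord`, dag-n09-w2∕w3, dag-p07 `B12GaugeOrbits021`); the within-block letter `hint`, the plaquette smallness (7), the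
next-level letter `α`, the (1.29) normalisation and the Landau copy are HYPOTHESES; the ROAD WORD ((S) radial ∕ (F) Federbush ∕ (T) display) is the lane owner's ∕ plan's — this file only makes
road (S) available by name; `Node00.contourOfRecord` and N09's gauge fixing `𝐆` are untouched; nothing of [B11]∕[6]∕[B5]∕[3] analysis asserted; `stub_prop8StepCoP13` ∕ K0⁷ ∕ K1⁹ NOT closed;
N07 NOT discharged; the chair's tally of record is the only count; **no summit statement is proved by this seat** — one finite `T⁴` programme at fixed `ε`, Bałaban AS PRINTED; the route closes
the conditional finite-𝕋⁴ rung `BalabanLadder.UV` only; NOT continuum ∕ ℝ⁴ ∕ OS ∕ mass gap ∕ Clay.  No `sorry`, no `def`, no `instance`, no `notation`.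
-/

noncomputable section

namespace Summit.QuantumFields.YangMills.BalabanUVNodes.N07RadialAxialTower

open scoped Matrix.Norms.L2Operator
open Literature.MathematicalPhysics.QuantumFieldTheory.Balaban1983to89
open Literature.MathematicalPhysics.QuantumFieldTheory.Balaban1983to89.Node00
open T4Continuum
open T4AxialGaugeSmallField (axialGauge)
open B12GaugeOrbits021 (IsResidual OrbitRel)
open B16Sect1Backgrounds (toMS)
open B15Eq177GaugeInvariance (blockLift)
open GaugeField (gaugeAct)
open ExpMeanLog (expMeanLogSU deltaSU)
open Summit.QuantumFields.Balaban3D.Carriers (radialContourData radialHol pathHol moveHol fwdHol coordsDesc radialContourData_holTo radialHol_one)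
open Summit.QuantumFields.YangMills.BalabanUVNodes.N07AxialTowerRepresentative (exists_residual_axialTower existsUnique_axialTower_in_orbit axialTower_gaugeAct_blockLift
  shearRIter_eq_one_of_axialTower)
open Summit.QuantumFields.YangMills.BalabanUVNodes.N09AxialSelectionExists (iter_gaugeAct_blockLift)
open Summit.QuantumFields.YangMills.BalabanUVNodes.N09LiftInvariance29AtRecord (gaugeAct_mem_bgReg)
open Summit.QuantumFields.YangMills.BalabanUVNodes.N07Lemma1CrossingBondsAtRecord (dist1_crossingBond_le_at_record)

/-! ## §1  Generic: the contour from the centre to the centre is empty -/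

section Generic

variable {P : Params} {j : ℕ} {G : Type*} [GaugeGroup G]

/-- A coordinate move to the coordinate one already has is the empty transport. [folklore] -/
theorem moveHol_self (U : GaugeField P j G) (μ : Fin P.d) (z : Site P j) : moveHol U μ (z μ) z = 1 := by
  unfold moveHol
  simp [fwdHol]

/-- The coordinate path from `x` to `x` (any coordinate list) has trivial holonomy. [folklore] -/
theorem pathHol_self (U : GaugeField P j G) (x : Site P j) : ∀ l : List (Fin P.d), pathHol U x l x = 1
  | [] => rfl
  | μ :: l => by
      show moveHol U μ (x μ) x * pathHol U x l (Function.update x μ (x μ)) = 1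
      rw [moveHol_self, Function.update_eq_self, pathHol_self U x l, one_mul]

/-- ★ **`U(Γ_{y,y}) = 1`**: the (1.7) contour from the block centre to itself is empty, for EVERY configuration (pub-balaban3d's `radialHol_one` is the case `U = 1`).
[cite: Balaban1984PropagatorsI, (1.7) p.18] -/
theorem radialHol_emb_self (U : GaugeField P j G) (y : Site P (j + 1)) : radialHol U y (emb y) = 1 :=
  pathHol_self U (emb y) _

variable (P G) in
/-- The `hctr` clause of this base's p608036 ∕ p610328 for the radial contour system, DISCHARGED at every level. [cite: Balaban1984PropagatorsI, (1.7) p.18] -/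
theorem radial_hctr : ∀ (i : ℕ) (U : GaugeField P i G) (y : Site P (i + 1)), (radialContourData P i G).holTo U y (emb y) = 1 :=
  fun _ U y => radialHol_emb_self U y

/-- The unit configuration is radial-axial at every level. [cite: Balaban1985RegularSpaces, (1.15) p.78 (bookkeeping)] -/
theorem axialGauge_radial_one (i : ℕ) : AxialGauge (radialContourData P i G) (1 : GaugeField P i G) :=
  fun y x _ _ => radialHol_one y x

end Generic

/-! ## §2  At the record: every residual orbit ∕ the minimiser of record carries the RADIAL tower; block-constant lifts keep it -/

section Record

variable (F : T4Continuum.T4Family) (N : ℕ) [NeZero N]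

/-- ★★ **EVERY RESIDUAL ORBIT CARRIES THE RADIAL AXIAL TOWER** ([6] (1.15) with (1.14), all levels `< j` at once, on [B5] (1.7)'s contours): for every torus `K`, `j ≤ m + K` and every `U` there is a
residual `w` (`w = 1` on `T^{(j)}`) with `M^i(U^w)` radial-axial at every `i < j` — this base's `exists_residual_axialTower` at `cd := radialContourData`.
[cite: Balaban1985RegularSpaces, (1.14)–(1.15) p.78; Balaban1985Variational, p.300 (Sect. F)] -/
theorem exists_residual_radialTower_record (K : ℕ) {j : ℕ} (hj : j ≤ (F.P K).m + (F.P K).K) (U : GaugeField (F.P K) 0 (SU N)) :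
    ∃ w : GaugeTransf (F.P K) 0 (SU N), IsResidual j w ∧
      ∀ i < j, AxialGauge (radialContourData (F.P K) i (SU N)) (Averaging.iter (avOfRecord F N K) i (gaugeAct w U)) :=
  exists_residual_axialTower (avOfRecord F N K) (fun i => radialContourData (F.P K) i (SU N)) j hj U

/-- ★★ **W.L.O.G. THE MINIMISER OF RECORD CARRIES THE RADIAL TOWER**: every minimiser `U₀` of the Wilson action of record on `{M^k(U) = V} ∩ bgReg` has in its residual orbit of level `k` a
minimiser `U′` over the SAME data `V` whose averages `M^i(U′)`, `i < k`, are radial-axial (residual transformations keep `M^k` and `bgReg`: dag-p07 `isBackground_gaugeAct`, dag-n09-w2 `gaugeAct_mem_bgReg`).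
[cite: Balaban1985Variational, p.300–301 (Sect. F); Balaban1987RG1, (0.21) p.256] -/
theorem exists_radialTower_isBackground (K : ℕ) {k : ℕ} (hk : k ≤ (F.P K).m + (F.P K).K) {ε : ℝ} {V : GaugeField (F.P K) k (SU N)}
    {U₀ : GaugeField (F.P K) 0 (SU N)} (h : IsBackground (avOfRecord F N K) (bgReg F N K k ε) k V U₀) :
    ∃ U' : GaugeField (F.P K) 0 (SU N), OrbitRel k U₀ U' ∧ IsBackground (avOfRecord F N K) (bgReg F N K k ε) k V U' ∧
      ∀ i < k, AxialGauge (radialContourData (F.P K) i (SU N)) (Averaging.iter (avOfRecord F N K) i U') := by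
  obtain ⟨w, hres, hax⟩ := exists_residual_radialTower_record F N K hk U₀
  exact ⟨gaugeAct w U₀, ⟨w, hres, rfl⟩,
    B12GaugeOrbits021.isBackground_gaugeAct hk (fun u _ U hU => gaugeAct_mem_bgReg u U hU) h hres, hax⟩

/-- ★ **(1.15)'s uniqueness on the radial contours**: each residual orbit of level `j ≤ m + K` contains EXACTLY ONE configuration carrying the radial tower (p610328 `existsUnique_axialTower_in_orbit`).
[cite: Balaban1985RegularSpaces, (1.14)–(1.15) p.78 («determine uniquely an element in each orbit»)] -/
theorem existsUnique_radialTower_in_orbit (K : ℕ) {j : ℕ} (hj : j ≤ (F.P K).m + (F.P K).K) (U : GaugeField (F.P K) 0 (SU N)) :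
    ∃! U' : GaugeField (F.P K) 0 (SU N), OrbitRel j U U' ∧ ∀ i < j, AxialGauge (radialContourData (F.P K) i (SU N)) (Averaging.iter (avOfRecord F N K) i U') :=
  existsUnique_axialTower_in_orbit (avOfRecord F N K) (fun i => radialContourData (F.P K) i (SU N)) hj U

/-- **Block-constant lifts from level `j` keep the radial tower** (the representative `U′^{h̄}` of this base's `…TowerGauge` `_of_rep` forms stays radial-axial below `j`).
[cite: Balaban1985Variational, (147) p.301, (181) p.307; Balaban1985RegularSpaces, (1.15) p.78] -/
theorem radialTower_gaugeAct_blockLift (K : ℕ) {j : ℕ} (hj : j ≤ (F.P K).m + (F.P K).K) (h : GaugeTransf (F.P K) j (SU N)) (U' : GaugeField (F.P K) 0 (SU N))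
    (hax : ∀ i < j, AxialGauge (radialContourData (F.P K) i (SU N)) (Averaging.iter (avOfRecord F N K) i U')) :
    ∀ i < j, AxialGauge (radialContourData (F.P K) i (SU N)) (Averaging.iter (avOfRecord F N K) i (gaugeAct (blockLift j h) U')) :=
  axialTower_gaugeAct_blockLift (avOfRecord F N K) (fun i => radialContourData (F.P K) i (SU N)) j hj h U' hax

end Record

/-! ## §3  The shear letters (85)–(88) on the radial tower -/

section Shear

variable (F : T4Continuum.T4Family) (N : ℕ) [NeZero N]

/-- ★ **`S_j(U′) = 1` on the radial tower** (the intrinsic factor of [3] (85) for the radial contour letters; p610328 §2 with `radial_hctr`). [cite: Balaban1985Averaging, (85) p.31] -/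
theorem shearRIter_radial_eq_one_of_axialTower (K : ℕ) {U' : GaugeField (F.P K) 0 (SU N)} {j : ℕ}
    (hax : ∀ i < j, AxialGauge (radialContourData (F.P K) i (SU N)) (Averaging.iter (avOfRecord F N K) i U')) :
    shearRIter (avOfRecord F N K) (fun i => radialContourData (F.P K) i (SU N)) (loopAvgBlockOp expMeanLogSU) U' j = fun _ => 1 :=
  shearRIter_eq_one_of_axialTower _ _ _ (loopAvgBlockOp_congr_one expMeanLogSU (expMeanLogSU_E_one' N)) (radial_hctr (F.P K) (SU N)) j hax

/-- ★★ **(88)∕(154)₁ AT THE RECORD ON THE RADIAL TOWER, `hctr` DISCHARGED**: for the averaging of record, `j ≤ m + K`, any `u`, `U₁` whose representative `U₁^{u}` carries the radial tower below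
`j`, and the (81)∕(1.29) normalisation of `u` at the bond's ends, the sheared `j`-fold average with the RADIAL shear letters equals the plain average of the representative:
`𝒜_j(U₁)(c) = M^j(U₁^{u})(c)` — p608036 `shearedAvgIter_avOfRecord_eq_iter_gauge_cd` at `radialContourData`. [cite: Balaban1985Averaging, (88) p.31; Balaban1985Variational, (154) p.302] -/
theorem shearedAvgIter_radial_eq_iter_gauge (K : ℕ) {u : GaugeTransf (F.P K) 0 (SU N)} {U₁ : GaugeField (F.P K) 0 (SU N)} {j : ℕ}
    (hj : j ≤ (F.P K).m + (F.P K).K)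
    (hax : ∀ i < j, AxialGauge (radialContourData (F.P K) i (SU N)) (Averaging.iter (avOfRecord F N K) i (gaugeAct u U₁)))
    {c : PBond (F.P K) j} (hsrc : gaugeAvgIter (loopAvgBlockOp expMeanLogSU) u j c.src = 1) (htgt : gaugeAvgIter (loopAvgBlockOp expMeanLogSU) u j c.tgt = 1) :
    shearedAvgIter (avOfRecord F N K) (fun i => radialContourData (F.P K) i (SU N)) (loopAvgBlockOp expMeanLogSU) U₁ j c =
      Averaging.iter (avOfRecord F N K) j (gaugeAct u U₁) c :=
  shearedAvgIter_avOfRecord_eq_iter_gauge_cd F N K _ (radial_hctr (F.P K) (SU N)) hj hax hsrc htgt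

/-- ★★ **(154)₁ ON THE RADIAL TOWER IN THE KNIT'S SHAPE**: `U′` carries the radial tower below `j`, `V := M^j(U′)`, `h := axialGauge V lo hi`, the pair `(u, U₁)` has `U₁^{u} = U′^{h̄}` and the
(1.29) normalisation at the bond's ends — then `𝒜_j(U₁)(c) = (V^h)(c)` (tower kept by `radialTower_gaugeAct_blockLift`, data by dag-n09-w3's `iter_gaugeAct_blockLift`).
[cite: Balaban1985Variational, (147) p.301, (154) p.302; Balaban1985Averaging, (88) p.31] -/
theorem shearedAvgIter_radial_eq_dataAxial_of_rep (K : ℕ) {j : ℕ} (hj : j ≤ (F.P K).m + (F.P K).K) (U' : GaugeField (F.P K) 0 (SU N))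
    (hax : ∀ i < j, AxialGauge (radialContourData (F.P K) i (SU N)) (Averaging.iter (avOfRecord F N K) i U'))
    (u : GaugeTransf (F.P K) 0 (SU N)) (U₁ : GaugeField (F.P K) 0 (SU N)) (lo hi : Fin (F.P K).d → ℤ)
    (hrep : gaugeAct u U₁ = gaugeAct (blockLift j (axialGauge (Averaging.iter (avOfRecord F N K) j U') lo hi)) U')
    {c : PBond (F.P K) j} (hsrc : gaugeAvgIter (loopAvgBlockOp expMeanLogSU) u j c.src = 1) (htgt : gaugeAvgIter (loopAvgBlockOp expMeanLogSU) u j c.tgt = 1) :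
    shearedAvgIter (avOfRecord F N K) (fun i => radialContourData (F.P K) i (SU N)) (loopAvgBlockOp expMeanLogSU) U₁ j c =
      gaugeAct (axialGauge (Averaging.iter (avOfRecord F N K) j U') lo hi) (Averaging.iter (avOfRecord F N K) j U') c := by
  have hax' : ∀ i < j, AxialGauge (radialContourData (F.P K) i (SU N)) (Averaging.iter (avOfRecord F N K) i (gaugeAct u U₁)) := by
    rw [hrep]; exact radialTower_gaugeAct_blockLift F N K hj _ U' hax
  rw [shearedAvgIter_radial_eq_iter_gauge F N K hj hax' hsrc htgt, hrep, iter_gaugeAct_blockLift (avOfRecord F N K) hj _ U']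

end Shear

/-! ## §4  One step of (155) down the tower: n07-w5's Lemma 1 at the representative's own averages -/

section Step

variable {F : T4Continuum.T4Family} {N : ℕ} [NeZero N]

/-- ★★ **ONE STEP OF (155) DOWN THE TOWER** ([6] Lemma 1 (1.25) in n07-w5's (0.4) reading, at `W := M^j(U′)`): for ANY `U′`, `j + 1 ≤ m + K` and a `(j+1)`-bond `c = ⟨c₋, μ⟩`: if the level-`j`
plaquettes of `M^j U′` based in `B(c₋ − e_μ) ∪ B(c₋) ∪ B(c₊)` are `< a` with `t := ((d+2)L)²∕4·a < δ_N`, the NEXT level's letter `dist1 (M^{j+1}U′(c)) ≤ α` and the within-block letter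
`dist1 (M^j U′ b) ≤ τ` on the bonds inside `B(c₋)`, `B(c₊)` (`hint`, DISPLAYED — on the radial tower it is the tree-gauge count from `AxialGauge (radialContourData …) (M^j U′)`), then every
far-face crossing bond (`x = blockSite c₋ r`, `r_μ = L − 1`) obeys `dist1 (M^j U′ ⟨x, μ⟩) ≤ α + 7t + (d+1)(L−1)·τ` — n07-w5's `dist1_crossingBond_le_at_record`, `M^{j+1} = (avOfRecord j).avg ∘ M^j`.
[cite: Balaban1985RegularSpaces, Lemma 1 (1.25) p.79; Balaban1985Variational, (155) p.302, (160) p.303] -/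
theorem dist1_crossingBond_iter_le_of_succ {K j : ℕ} (hj : j + 1 ≤ (F.P K).m + (F.P K).K) (U' : GaugeField (F.P K) 0 (SU N)) {a α τ : ℝ}
    (ha : 0 ≤ a) (hτ : 0 ≤ τ) (c : PBond (F.P K) (j + 1))
    (hW : ∀ q : Plaq (F.P K) j, (blockOf q.src = c.src.unshift c.dir ∨ blockOf q.src = c.src ∨ blockOf q.src = c.tgt) →
      dist1 (GaugeField.plaqHol (Averaging.iter (avOfRecord F N K) j U') q) < a)
    (ht : (((((F.P K).d + 2) * (F.P K).L : ℕ) : ℝ) ^ 2 / 4) * a < deltaSU (Fin N))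
    (hα : dist1 (Averaging.iter (avOfRecord F N K) (j + 1) U' c) ≤ α)
    (hint : ∀ b : PBond (F.P K) j, blockOf b.src = blockOf b.tgt → (blockOf b.src = c.src ∨ blockOf b.src = c.tgt) →
      dist1 (Averaging.iter (avOfRecord F N K) j U' b) ≤ τ)
    (r : Fin (F.P K).d → Fin (F.P K).L) (hr : (r c.dir : ℕ) = (F.P K).L - 1) (σ σ' : Equiv.Perm (Fin (F.P K).d)) :
    dist1 (Averaging.iter (avOfRecord F N K) j U' ⟨Site.blockSite c.src r, c.dir⟩) ≤
      α + 7 * ((((((F.P K).d + 2) * (F.P K).L : ℕ) : ℝ) ^ 2 / 4) * a) + ((((F.P K).d + 1) * ((F.P K).L - 1) : ℕ) : ℝ) * τ :=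
  dist1_crossingBond_le_at_record hj ha hτ c hW ht hα hint r hr σ σ'

end Step

/-! ## §5  (A6) Non-vacuity: the unit configuration carries the radial tower -/

section NonVacuity

variable (F : T4Continuum.T4Family) (N : ℕ) [NeZero N]

/-- At the unit configuration every average of record is `1` and every radial contour holonomy is `1`: the radial tower of every depth holds (`iter_avOfRecord_one`, `radialHol_one`) — with
`w := 1` this inhabits §2, and with `(u, U₁) := (1, 1)` and p608036's `gaugeAvgIter_loopAvgBlockOp_one` the binders of §3. [cite: Balaban1985RegularSpaces, (1.15) p.78 (bookkeeping)] -/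
theorem radialTower_one (K : ℕ) : ∀ i : ℕ, AxialGauge (radialContourData (F.P K) i (SU N)) (Averaging.iter (avOfRecord F N K) i (1 : GaugeField (F.P K) 0 (SU N))) := by
  intro i
  rw [B15Claim189UnitTestAtRecord.iter_avOfRecord_one F N K i]
  exact axialGauge_radial_one i

end NonVacuity

end Summit.QuantumFields.YangMills.BalabanUVNodes.N07RadialAxialTower
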